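import Summits.PneNP.PneNP.Theorems.SymmetryBudgetWindowCanoniserSoundB2

/-!
# Window canoniser, XXVII: soundness at section nodes, III — decoding the pasting; soundness

Route `PneNP/SymmetryBudget`, dichotomy `WindowBarrier` (stmt-PneNP-2145) / `NoHiddenOrder` (stmt-PneNP-14781);
continuation of `…WindowCanoniserSoundB2.lean`.  In the context of a section node the address atoms decode to the
interval structure (`WCan.SecCtx.patP_iff`, `offP_iff`, `samePartP_iff`, `spcP_iff`); the value bits and
soundness follow in `…WindowCanoniserSoundB4.lean`.
-/

-- `Summit.PneNP.PneNP.…` duplicates `PneNP` BY DESIGN (single-problem summit, D-0017 layout).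
set_option linter.dupNamespace false

noncomputable section

namespace Summit.PneNP.PneNP.Theorems

namespace WCan

open Finset Literature.Computability.Complexity Literature.Computability.Complexity.CGCanon
  Literature.Combinatorics.SimpleGraph
open scoped Classical

variable {K r n : ℕ} [NeZero n]

namespace SecCtx

variable {L : Lab K n} {x : Fin (r + n) × Fin (r + n) → Bool} {ordK : Finset (Fin n) → ℕ → Fin n} (C : SecCtx L x ordK)
  (hn : 2 ≤ n)
include C


/-! ### Transfers between parts with the same vector -/

/-- Same vector: the vertices at the same offset have the same colour. -/
theorem liftCol_transfer {K₁ K₂ : Finset (Fin n)} (h1 : K₁ ∈ P L x) (h2 : K₂ ∈ P L x) (h : vecK (L := L) (x := x) (ordK := ordK) K₁ = vecK (L := L) (x := x) (ordK := ordK) K₂) {o : ℕ} (ho : o < K₁.card) :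
    liftCol (finSt L.1 x).W (finSt L.1 x).c (ordK K₁ o) = liftCol (finSt L.1 x).W (finSt L.1 x).c (ordK K₂ o) := by
  have ho2 : o < K₂.card := by rw [← card_eq_of_vecK_eq h]; exact ho
  have hon : o < n := ho.trans_le (card_le_n K₁)
  have hm1 : ordK K₁ o ∈ (finSt L.1 x).W := by rw [C.hW]; exact (C.P_spec h1).1 ((C.validOrd_of_mem_P h1).1 o ho)
  have hm2 : ordK K₂ o ∈ (finSt L.1 x).W := by rw [C.hW]; exact (C.P_spec h2).1 ((C.validOrd_of_mem_P h2).1 o ho2)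
  have key := PV_iff_of_vecK_eq h (.crk ⟨o, hon⟩ ⟨rankF L.1 x (ordK K₁ o), rankS_lt _ _⟩)
  simp only [PV, bpdec_bpVal, bdec_benc, ho, ho2, true_and, true_iff] at key
  rw [liftCol_of_mem _ hm1, liftCol_of_mem _ hm2, ceq_of_rankS_eq _ hm1 hm2 (by rw [← rankF_eq, ← rankF_eq, key])]

omit [NeZero n] C in
/-- Same vector: the same adjacency pattern. -/
theorem adj_transfer {K₁ K₂ : Finset (Fin n)} (h : vecK (L := L) (x := x) (ordK := ordK) K₁ = vecK (L := L) (x := x) (ordK := ordK) K₂) {o o' : ℕ} (ho : o < K₁.card) (ho' : o' < K₁.card) :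
    (G x).Adj (ordK K₁ o) (ordK K₁ o') ↔ (G x).Adj (ordK K₂ o) (ordK K₂ o') := by
  have hon : o < n := ho.trans_le (card_le_n K₁)
  have hon' : o' < n := ho'.trans_le (card_le_n K₁)
  have key := PV_iff_of_vecK_eq h (.adj ⟨o, hon⟩ ⟨o', hon'⟩)
  have := card_eq_of_vecK_eq h
  have h2 : o < K₂.card := this ▸ ho
  have h2' : o' < K₂.card := this ▸ ho'
  simp only [PV, bpdec_bpVal, bdec_benc, ho, ho', h2, h2', true_and] at key
  exact key

omit [NeZero n] C in
/-- Same vector: the same outside bits. -/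
theorem ext_transfer {K₁ K₂ : Finset (Fin n)} (h : vecK (L := L) (x := x) (ordK := ordK) K₁ = vecK (L := L) (x := x) (ordK := ordK) K₂) {o : ℕ} (ho : o < K₁.card) (oo : Fin r) :
    xo x (ordK K₁ o) oo = xo x (ordK K₂ o) oo := by
  have hon : o < n := ho.trans_le (card_le_n K₁)
  have key := PV_iff_of_vecK_eq h (.ext ⟨o, hon⟩ oo)
  have := card_eq_of_vecK_eq h
  have h2 : o < K₂.card := this ▸ ho
  simp only [PV, bpdec_bpVal, bdec_benc, ho, h2, true_and] at key
  exact Bool.eq_iff_iff.2 key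

/-! ### Blocks -/

omit [NeZero n] C in
/-- Blocks of smaller vectors end before blocks of larger vectors start. -/
theorem block_le_of_lt {V₁ V₂ : Lex (Fin (NBp r n) → Bool)} (h : V₁ < V₂) : bstart (L := L) (x := x) (ordK := ordK) V₁ + bsize (L := L) (x := x) (ordK := ordK) V₁ ≤ bstart (L := L) (x := x) (ordK := ordK) V₂ := by
  simp only [bstart, bsize]
  rw [← card_union_of_disjoint]
  · refine card_le_card fun w hw => ?_
    rw [mem_union, mem_filter, mem_filter] at hw
    rw [mem_filter]
    rcases hw with ⟨hwU, hlt⟩ | ⟨hwU, heq⟩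
    exacts [⟨hwU, hlt.trans h⟩, ⟨hwU, heq ▸ h⟩]
  · exact disjoint_left.2 fun w h1 h2 => (mem_filter.1 h1).2.ne (mem_filter.1 h2).2

include hn

/-- `pstart` of a member of `U` is the start of the block of its vector. -/
theorem pstart_eq {u : Fin n} (hu : u ∈ L.1.U) : pstart (r := r) L x u = bstart (L := L) (x := x) (ordK := ordK) (toLex (vecK (L := L) (x := x) (ordK := ordK) (Kf L x u))) := by
  rw [pstart, bstart, C.hW]
  congr 1
  refine filter_congr fun w hw => ?_
  rw [C.pvec_eq hw hn, C.pvec_eq hu hn]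

/-- `pbc` of a member of `U` is the size of the block of its vector. -/
theorem pbc_eq {u : Fin n} (hu : u ∈ L.1.U) : pbc (r := r) L x u = bsize (L := L) (x := x) (ordK := ordK) (toLex (vecK (L := L) (x := x) (ordK := ordK) (Kf L x u))) := by
  rw [pbc, bsize, C.hW]
  congr 1
  refine filter_congr fun w hw => ?_
  rw [C.pvec_eq hw hn, C.pvec_eq hu hn, ← toLex_inj]

omit hn in
/-- The vector of the part of a position inside the block of `V` is `V`. -/
theorem vecK_Kp_of_mem_block {p : ℕ} {V : Lex (Fin (NBp r n) → Bool)} (h1 : bstart (L := L) (x := x) (ordK := ordK) V ≤ p) (h2 : p < bstart (L := L) (x := x) (ordK := ordK) V + bsize (L := L) (x := x) (ordK := ordK) V) :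
    toLex (vecK (L := L) (x := x) (ordK := ordK) (Kp (L := L) (x := x) (ordK := ordK) p)) = V := by
  have hp : p < L.1.U.card := h2.trans_le (bstart_add_bsize_le V)
  obtain ⟨hKp, hc1, hc2⟩ := C.Kp_spec hp
  have hb1 := bstart_le_cstart (L := L) (x := x) (ordK := ordK) (Kp (L := L) (x := x) (ordK := ordK) p)
  have hb2 := C.cstart_add_card_le_block hKp
  by_contra hne
  rcases lt_or_gt_of_ne hne with h | h
  · have := block_le_of_lt (L := L) (x := x) (ordK := ordK) h; omega
  · have := block_le_of_lt (L := L) (x := x) (ordK := ordK) h; omega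

omit hn in
/-- The interval of a part of vector `V` and size `s` starts at `bstart V + i s` for some `i`. -/
theorem cstart_eq_bstart_add {K' : Finset (Fin n)} :
    ∃ i, cstart (L := L) (x := x) (ordK := ordK) K' = bstart (L := L) (x := x) (ordK := ordK) (toLex (vecK (L := L) (x := x) (ordK := ordK) K')) + i * K'.card := by
  obtain ⟨m, hm⟩ := C.dvd_cstart_sub K'
  have := bstart_le_cstart (L := L) (x := x) (ordK := ordK) K'
  exact ⟨m, by rw [mul_comm] at hm; omega⟩

/-! ### Decoding the addresses -/

omit C hn in
/-- An address holder lies in `U`. -/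
theorem mem_U_of_pbitP {u : Fin n} {i : Fin (NBp r n)} (h : pbitP (r := r) L x u i) : u ∈ L.1.U := by
  obtain ⟨U', hP, -⟩ := h; exact hP.1

/-- **`pat` decoded**: position `p` lies in the block of the vector of `Kf u`, the part of `p` starts at slot `i` of
that block, and `p` is at offset `o` in it. -/
theorem patP_iff {u : Fin n} (hu : u ∈ L.1.U) (p i o : Fin n) : patP (r := r) L x p u i o ↔
    ((p : ℕ) < L.1.U.card ∧ vecK (L := L) (x := x) (ordK := ordK) (Kp (L := L) (x := x) (ordK := ordK) p) = vecK (L := L) (x := x) (ordK := ordK) (Kf L x u) ∧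
      cstart (L := L) (x := x) (ordK := ordK) (Kp (L := L) (x := x) (ordK := ordK) p) = bstart (L := L) (x := x) (ordK := ordK) (toLex (vecK (L := L) (x := x) (ordK := ordK) (Kf L x u))) + i * (Kf L x u).card ∧ (p : ℕ) = cstart (L := L) (x := x) (ordK := ordK) (Kp (L := L) (x := x) (ordK := ordK) p) + o) := by
  set Ku := Kf L x u with hKu
  set V := toLex (vecK (L := L) (x := x) (ordK := ordK) Ku) with hV
  set s := Ku.card with hs
  have hsn : s ≤ n := card_le_n Ku
  have hbit : ∀ s' : Fin (n + 1), pbitP (r := r) L x u (bpSize s') ↔ s = (s' : ℕ) := by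
    intro s'; rw [C.pbitP_iff hu]; simp only [bpdec_bpSize, hs, hKu]
  unfold patP
  simp only [C.pstart_eq hn hu, C.pbc_eq hn hu, hbit, ← hKu, ← hV]
  constructor
  · rintro ⟨s', ho, hle, -, hst, hss, hbc⟩
    rw [← hss] at ho hle hst hbc
    have hmul : ((i : ℕ) + 1) * s = i * s + s := Nat.succ_mul _ _
    have hbU := bstart_add_bsize_le (L := L) (x := x) (ordK := ordK) V
    have hpU : (p : ℕ) < L.1.U.card := by omega
    have hvec : toLex (vecK (L := L) (x := x) (ordK := ordK) (Kp (L := L) (x := x) (ordK := ordK) p)) = V := C.vecK_Kp_of_mem_block (V := V) (by omega) (by omega)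
    have hvec' : vecK (L := L) (x := x) (ordK := ordK) (Kp (L := L) (x := x) (ordK := ordK) p) = vecK (L := L) (x := x) (ordK := ordK) Ku := toLex_inj.1 hvec
    have hcard : (Kp (L := L) (x := x) (ordK := ordK) p).card = s := card_eq_of_vecK_eq hvec'
    obtain ⟨hKp, hc1, hc2⟩ := C.Kp_spec hpU
    obtain ⟨m, hm⟩ := C.cstart_eq_bstart_add (K' := Kp (L := L) (x := x) (ordK := ordK) p)
    rw [hvec, hcard] at hm
    rw [hcard] at hc2
    have hmul' : (m + 1) * s = m * s + s := Nat.succ_mul _ _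
    have hmi : m = i := by
      have e1 : ((i : ℕ) * s + o) / s = i := Nat.div_eq_of_lt_le (by omega) (by omega)
      have e2 : ((i : ℕ) * s + o) / s = m := Nat.div_eq_of_lt_le (by omega) (by omega)
      omega
    subst hmi
    exact ⟨hpU, hvec', hm, by omega⟩
  · rintro ⟨hpU, hvec', hcs, hpo⟩
    obtain ⟨hKp, hc1, hc2⟩ := C.Kp_spec hpU
    have hcard : (Kp (L := L) (x := x) (ordK := ordK) p).card = s := card_eq_of_vecK_eq hvec'
    have hblk := C.cstart_add_card_le_block hKp
    rw [hvec', ← hV, hcard] at hblk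
    rw [hcard] at hc2
    have hbU := bstart_add_bsize_le (L := L) (x := x) (ordK := ordK) V
    have hUn : L.1.U.card ≤ n := (card_le_univ _).trans_eq (by simp)
    have hmul : ((i : ℕ) + 1) * s = i * s + s := Nat.succ_mul _ _
    refine ⟨⟨s, Nat.lt_succ_of_le hsn⟩, show (o : ℕ) < s from ?_, show (i : ℕ) * s + o ≤ p from ?_, show ((i : ℕ) + 1) * s ≤ n from ?_,
      show bstart (L := L) (x := x) (ordK := ordK) V = (p : ℕ) - ((i : ℕ) * s + o) from ?_, rfl, show ((i : ℕ) + 1) * s ≤ bsize (L := L) (x := x) (ordK := ordK) V from ?_⟩ <;> omega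

/-- **`off` decoded.** -/
theorem offP_iff {u : Fin n} (hu : u ∈ L.1.U) (p o : Fin n) : offP (r := r) L x p u o ↔
    ((p : ℕ) < L.1.U.card ∧ vecK (L := L) (x := x) (ordK := ordK) (Kp (L := L) (x := x) (ordK := ordK) p) = vecK (L := L) (x := x) (ordK := ordK) (Kf L x u) ∧ (p : ℕ) = cstart (L := L) (x := x) (ordK := ordK) (Kp (L := L) (x := x) (ordK := ordK) p) + o) := by
  unfold offP
  simp only [C.patP_iff hn hu]
  constructor
  · rintro ⟨i, h1, h2, -, h4⟩; exact ⟨h1, h2, h4⟩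
  · rintro ⟨h1, h2, h4⟩
    obtain ⟨m, hm⟩ := C.cstart_eq_bstart_add (K' := Kp (L := L) (x := x) (ordK := ordK) p)
    rw [h2, card_eq_of_vecK_eq h2] at hm
    obtain ⟨hKp, hc1, hc2⟩ := C.Kp_spec h1
    have hpos := C.card_Kf_pos hu
    have hmn : m < n := by
      have hle := C.cstart_add_card_le hKp
      rw [card_eq_of_vecK_eq h2] at hle
      have hUn : L.1.U.card ≤ n := (card_le_univ _).trans_eq (by simp)
      by_contra hge; rw [not_lt] at hge
      have : n * (Kf L x u).card ≤ m * (Kf L x u).card := Nat.mul_le_mul_right _ hge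
      have : n ≤ n * (Kf L x u).card := Nat.le_mul_of_pos_right n hpos
      omega
    exact ⟨⟨m, hmn⟩, h1, h2, hm, h4⟩

omit C hn in
/-- `off` forces the holder into `U`. -/
theorem mem_U_of_offP {p u o : Fin n} (h : offP (r := r) L x p u o) : u ∈ L.1.U := by
  obtain ⟨i, s, -, -, -, -, hb, -⟩ := h; exact mem_U_of_pbitP hb

omit hn in
/-- Parts are determined by their starts. -/
theorem eq_of_cstart_eq {K₁ K₂ : Finset (Fin n)} (h1 : K₁ ∈ P L x) (h2 : K₂ ∈ P L x) (h : cstart (L := L) (x := x) (ordK := ordK) K₁ = cstart (L := L) (x := x) (ordK := ordK) K₂) : K₁ = K₂ := by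
  by_contra hne
  have hpos1 : 0 < K₁.card := card_pos.2 (C.P_spec h1).2.1
  have hpos2 : 0 < K₂.card := card_pos.2 (C.P_spec h2).2.1
  rcases lt_trichotomy (ckey (L := L) (x := x) (ordK := ordK) K₁) (ckey (L := L) (x := x) (ordK := ordK) K₂) with hlt | heq | hgt
  · have := C.cstart_add_card_le_cstart h1 hlt; omega
  · exact hne (C.eq_of_ckey_eq h1 h2 heq)
  · have := C.cstart_add_card_le_cstart h2 hgt; omega

/-- **`samePart` decoded**: both positions are in range and in the same part. -/
theorem samePartP_iff (p q : Fin n) : samePartP (r := r) L x p q ↔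
    ((p : ℕ) < L.1.U.card ∧ (q : ℕ) < L.1.U.card ∧ Kp (L := L) (x := x) (ordK := ordK) p = Kp (L := L) (x := x) (ordK := ordK) q) := by
  unfold samePartP
  constructor
  · rintro ⟨u, i, ⟨o, ho⟩, ⟨o', ho'⟩⟩
    have hu : u ∈ L.1.U := mem_U_of_offP ⟨i, ho⟩
    rw [C.patP_iff hn hu] at ho ho'
    obtain ⟨hp, -, hcp, -⟩ := ho
    obtain ⟨hq, -, hcq, -⟩ := ho'
    exact ⟨hp, hq, C.eq_of_cstart_eq (C.Kp_spec hp).1 (C.Kp_spec hq).1 (hcp.trans hcq.symm)⟩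
  · rintro ⟨hp, hq, he⟩
    have hu : ORD (L := L) (x := x) (ordK := ordK) p ∈ L.1.U := C.validOrd_ORD.1 p hp
    have hKf : Kf L x (ORD (L := L) (x := x) (ordK := ordK) p) = Kp (L := L) (x := x) (ordK := ordK) p := C.Kf_ORD hp
    obtain ⟨m, hm⟩ := C.cstart_eq_bstart_add (K' := Kp (L := L) (x := x) (ordK := ordK) p)
    obtain ⟨hKp, hc1, hc2⟩ := C.Kp_spec hp
    obtain ⟨hKq, hq1, hq2⟩ := C.Kp_spec hq
    have hmn : m < n := by
      have hle := C.cstart_add_card_le hKp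
      have hUn : L.1.U.card ≤ n := (card_le_univ _).trans_eq (by simp)
      have hpos : 0 < (Kp (L := L) (x := x) (ordK := ordK) p).card := card_pos.2 (C.P_spec hKp).2.1
      by_contra hge; rw [not_lt] at hge
      have : n * (Kp (L := L) (x := x) (ordK := ordK) p).card ≤ m * (Kp (L := L) (x := x) (ordK := ordK) p).card := Nat.mul_le_mul_right _ hge
      have : n ≤ n * (Kp (L := L) (x := x) (ordK := ordK) p).card := Nat.le_mul_of_pos_right n hpos
      omega
    rw [← he] at hq1 hq2
    refine ⟨ORD (L := L) (x := x) (ordK := ordK) p, ⟨m, hmn⟩, ⟨⟨(p : ℕ) - cstart (L := L) (x := x) (ordK := ordK) (Kp (L := L) (x := x) (ordK := ordK) p), by omega⟩, ?_⟩, ⟨⟨(q : ℕ) - cstart (L := L) (x := x) (ordK := ordK) (Kp (L := L) (x := x) (ordK := ordK) p), by omega⟩, ?_⟩⟩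
    · rw [C.patP_iff hn hu, hKf]
      exact ⟨hp, rfl, hm, show (p : ℕ) = cstart (L := L) (x := x) (ordK := ordK) (Kp (L := L) (x := x) (ordK := ordK) p) + ((p : ℕ) - cstart (L := L) (x := x) (ordK := ordK) (Kp (L := L) (x := x) (ordK := ordK) p)) by omega⟩
    · rw [C.patP_iff hn hu, hKf]
      exact ⟨hq, by rw [← he], by rw [← he]; exact hm, show (q : ℕ) = cstart (L := L) (x := x) (ordK := ordK) (Kp (L := L) (x := x) (ordK := ordK) q) + ((q : ℕ) - cstart (L := L) (x := x) (ordK := ordK) (Kp (L := L) (x := x) (ordK := ordK) p)) by rw [← he]; omega⟩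

/-- **`spc` decoded**: the vertex at position `p` has the colour of `w`. -/
theorem spcP_iff (p w : Fin n) : spcP (r := r) L x p w ↔ ((p : ℕ) < L.1.U.card ∧ EQP (r := r) L x (ORD (L := L) (x := x) (ordK := ordK) p) w) := by
  unfold spcP
  constructor
  · rintro ⟨u, o, hoff, U', hP, hpc⟩
    have hu : u ∈ L.1.U := mem_U_of_offP hoff
    rw [C.isPartP_iff] at hP
    obtain ⟨-, rfl⟩ := hP
    rw [C.pcPP_iff hu] at hpc
    rw [C.offP_iff hn hu] at hoff
    obtain ⟨hp, hvec, hpo⟩ := hoff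
    obtain ⟨ho, heq⟩ := hpc
    refine ⟨hp, ?_⟩
    rw [EQP_iff] at heq ⊢
    rw [← heq, ORD, ← C.liftCol_transfer (C.Kp_spec hp).1 (Kf_mem_P hu) hvec (by rw [card_eq_of_vecK_eq hvec]; exact ho),
      show (p : ℕ) - cstart (L := L) (x := x) (ordK := ordK) (Kp (L := L) (x := x) (ordK := ordK) p) = o by omega]
  · rintro ⟨hp, heq⟩
    have hu : ORD (L := L) (x := x) (ordK := ordK) p ∈ L.1.U := C.validOrd_ORD.1 p hp
    have hKf : Kf L x (ORD (L := L) (x := x) (ordK := ordK) p) = Kp (L := L) (x := x) (ordK := ordK) p := C.Kf_ORD hp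
    obtain ⟨hKp, hc1, hc2⟩ := C.Kp_spec hp
    have hon : (p : ℕ) - cstart (L := L) (x := x) (ordK := ordK) (Kp (L := L) (x := x) (ordK := ordK) p) < n := by have := card_le_n (Kp (L := L) (x := x) (ordK := ordK) p); omega
    refine ⟨ORD (L := L) (x := x) (ordK := ordK) p, ⟨_, hon⟩, ?_, Kp (L := L) (x := x) (ordK := ordK) p, by rw [C.isPartP_iff, hKf]; exact ⟨hu, rfl⟩, ?_⟩
    · rw [C.offP_iff hn hu, hKf]; exact ⟨hp, rfl, show (p : ℕ) = cstart (L := L) (x := x) (ordK := ordK) (Kp (L := L) (x := x) (ordK := ordK) p) + ((p : ℕ) - cstart (L := L) (x := x) (ordK := ordK) (Kp (L := L) (x := x) (ordK := ordK) p)) by omega⟩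
    · have := (C.pcPP_iff hu ⟨_, hon⟩ w).2 (by rw [hKf]; exact ⟨show (p : ℕ) - cstart (L := L) (x := x) (ordK := ordK) (Kp (L := L) (x := x) (ordK := ordK) p) < (Kp (L := L) (x := x) (ordK := ordK) p).card by omega, heq⟩)
      rw [hKf] at this; exact this

end SecCtx

end WCan

end Summit.PneNP.PneNP.Theorems

end
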